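import Summits.BirchSwinnertonDyer.Rank1Residual.X11b.Three.ZhangAtThreePrime
import HarnessLib

/-!
# TYPED CONJECTURE Z₃-ns = Z₃″ (cell `bsd-stepL`, seat `bsd-stepL-koly`; memo `koly/MEMO-v3.1.md`, referee
# PASS `referee/VERDICT-KOLY-MEMO-v3-g12.md` + its adoption path; planner ruling (R-aa)) — Kolyvagin's
# conjecture mod 3 at a NON-SPLIT multiplicative `3 ∥ N` WITHOUT the hypothesis "`E[3]` not finite at 3"
# of `ZhangAtThree{,Prime}` (same directory)

FILED per the planner's ruling (R-aa) step (3) (TARGET.md v1.22 §0: "on PASS … koly proposes the tree twin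
under `X11b/Three/` shaped exactly like p399294 (@[conjecture] decl + bridge to `ZhangAtThreePrime` +
consumer)"), after referee g12's verdict (GAP(§3 root parity) with a pre-approved rank-free repair, every
other item PASS; the repair is folded in `koly/MEMO-v3.1.md`, which per the verdict's adoption path makes it
PASS). HONEST FRAMING: `ZhangAtThreeNonsplit` is a hypothesis-shaped `Prop`; NOTHING asserts it;
`@[conjecture]`. The theorems below say only: (1) on curves NON-SPLIT at 3, Z₃-ns implies Z₃′ (Z₃′ has MORE
hypotheses there — bookkeeping); (2) IF Z₃-ns holds then STEP L (`X11b.IndexLowerBoundAt W 3 K y_K`)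
follows from the McCallum fact exactly as for Z₃ / Z₃′. The memo-level proof chain (MEMO-v3.1: W. Zhang's
induction ROOTED at `E` with 3-good level-raised nodes from Gee 2011 Cor. 3.1.7 with the Barsotti–Tate
type; Manning–Shotton 2021 for Ihara; Lemmas N, P; R-SU3-good; Dokchitser–Dokchitser parity at the root)
is memo mathematics of the same standing as Z₃'s (conditional on published inputs taken as printed at
`p = 3`, the in-cell repair R-SU3 of a flagged printed proof, and audited transports) — NOT a kernel
object. `ZhangAtThree{,Prime}` are untouched. A sharper HOME proposal without the ♥(2)-binder (vi)
(`koly/ZhangAtThreeNonsplitSharpStandalone.lean`, ADDENDUM-A1) awaits its own referee verdict.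

Why the finiteness hypothesis can be dropped for NON-SPLIT 3 (MEMO-v3 §0–§3): with `a₃ = −1`
Frobenius acts by `−1` on the 3-part of every component group at 3 in the congruence class and on the
étale quotient of every good-ordinary member, so the mod-`𝔭` Kummer condition at `w ∣ 3` is ONE
`𝔽₃`-rational line `H¹_ord` for the multiplicative curve and for all level-raised nodes (Lemma N), and
W. Zhang's induction can be ROOTED at `E` with 3-good auxiliary nodes (and hypothesis (vi) =
Zhang's ♥(2) for them); in the SPLIT-finite case (`3 ∣ c₃`, atom T2′) exactly this fails. Census (planner
K-Z3″ typed re-run + referee g12 recount, two engines): TRUE-OPEN A1 locus 906 (Z₃′) → 967 of 1 116;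
class-wide below 5·10⁵: 177 754 → 207 918 (83.5 % of A1).
-/

noncomputable section

open scoped Classical

namespace Summit.BirchSwinnertonDyer.Rank1Residual.X11b.Three.Koly

open WeierstrassCurve Literature.NumberTheory.EllipticCurves
  Literature.NumberTheory.EllipticCurves.ModularForms

/-- **Conjecture Z₃-ns (typed; NOT asserted)** — Kolyvagin's conjecture mod 3 for `E/ℚ`
with NON-SPLIT multiplicative reduction at `3 ∥ N`. Binders: `W` globally minimal; `3 ∥ N`
multiplicative and NOT split; `ρ̄_{E,3}` onto; EITHER `3 ∤ v₃(Δ_min)` (then this is Z₃′ restricted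
to non-split 3) OR [`N` square-free ∨ `E` has two distinct multiplicative primes `≠ 3`] (W. Zhang's
Hypothesis ♥(2) for the 3-good level-raised nodes of MEMO-v3); Ram: `∃ ℓ₀ ≠ 3` multiplicative with
`3 ∤ v_{ℓ₀}(Δ_min)`; `3 ∤ ∏ c_ℓ`; `K` imaginary quadratic, Heegner for `N_E`, `d_K ≠ −3`.
Conclusion in the currency of the tree's Kolyvagin facts (as `ZhangAtThree`). CONJECTURE (hypothesis-shaped `Prop`, nothing asserted; cell bsd-stepL, seat koly; memo `koly/MEMO-v3.1.md`, referee g12 PASS via its adoption path).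
[cite: WZhang2014, Thm. 1.1 (p. 195) and Thm. 9.1 (p. 240) — shape only, NOT printed at p = 3 nor at p ∣ N; nothing asserted] -/
@[conjecture] def ZhangAtThreeNonsplit (W : WeierstrassCurve ℚ) [W.IsElliptic] [W.IsGloballyMinimal]
    [NeZero (W.conductorNorm ℤ)] (K : Type) [Field K] [NumberField K] : Prop :=
  W.HasMultiplicativeReductionAtPrime 3 →
  ¬ W.HasSplitMultiplicativeReductionAtPrime 3 →
  W.HasSurjectiveModNGaloisRep 3 →
  (¬ 3 ∣ padicValInt 3 W.minimalDiscriminantInt ∨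
    (Squarefree (W.conductorNorm ℤ) ∨
      ∃ (ℓ₁ ℓ₂ : ℕ) (_ : Fact ℓ₁.Prime) (_ : Fact ℓ₂.Prime), ℓ₁ ≠ ℓ₂ ∧ ℓ₁ ≠ 3 ∧ ℓ₂ ≠ 3 ∧
        W.HasMultiplicativeReductionAtPrime ℓ₁ ∧ W.HasMultiplicativeReductionAtPrime ℓ₂)) →
  (∃ (ℓ : ℕ) (_ : Fact ℓ.Prime), ℓ ≠ 3 ∧ W.HasMultiplicativeReductionAtPrime ℓ ∧
      ¬ 3 ∣ padicValInt ℓ W.minimalDiscriminantInt) →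
  ¬ 3 ∣ W.tamagawaProduct →
  IsImaginaryQuadratic K → SatisfiesHeegnerHypothesis (W.conductorNorm ℤ) K →
  NumberField.discr K ≠ -3 →
  ∃ (Dt : ModularParametrizationData W (W.conductorNorm ℤ)) (β : ℤ) (ι : K →+* ℂ) (n : ℕ)
    (d : KolyvaginHeegnerData Dt β ι n),
    KolyvaginDescent.KolSupp (Zhang2014.IsKolyvaginPrime (W.conductorNorm ℤ) W K 3) n ∧
      d.kolyvaginClass Nat.prime_three 1 ≠ 0

/-- **Z₃-ns implies Z₃′ on curves NON-SPLIT at 3** (bookkeeping only; nothing asserted about either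
conjecture): under `¬ split(3)` the hypotheses of `ZhangAtThreePrime` contain those of `ZhangAtThreeNonsplit`
(`3 ∤ v₃(Δ_min)` gives the left disjunct of the «(ii) ∨ (vi)» binder; the split-3 `𝓛`-clause is not needed),
so on the non-split locus Z₃-ns is the STRONGER statement. [folklore] -/
theorem zhangAtThreePrime_of_zhangAtThreeNonsplit (W : WeierstrassCurve ℚ) [W.IsElliptic]
    [W.IsGloballyMinimal] [NeZero (W.conductorNorm ℤ)] (K : Type) [Field K] [NumberField K]
    (hns : ¬ W.HasSplitMultiplicativeReductionAtPrime 3) (h : ZhangAtThreeNonsplit W K) :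
    ZhangAtThreePrime W K :=
  fun hmult hρ hfin _ hram htam hK hH h3 ↦ h hmult hns hρ (Or.inl hfin) hram htam hK hH h3

/-- **Z₃-ns ⇒ STEP L at 3** on the non-split locus: the same McCallum consumer as for Z₃ / Z₃′
(`Koly.indexLowerBoundAt_of_kolyvaginClass_one_ne_zero_of_mccallum` at `p = 3`; tower surjectivity
at a multiplicative 3 discharged by `Rank1Residual.surjective_pow_three_of_mult_of_tateLine`,
Wuthrich 2014 Lemma 20). CONDITIONAL on `hMc`; `hZ : ZhangAtThreeNonsplit W K` is a HYPOTHESIS (open).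
[cite: McCallumLMS1991, §5 Cor. 5.6 (p. 310)] [cite: Wuthrich2014, Lemma 20 (p. 399)] -/
theorem exists_indexLowerBoundAt_three_of_zhangAtThreeNonsplit_of_mccallum
    (W : WeierstrassCurve ℚ) [W.IsElliptic] [W.IsGloballyMinimal] [NeZero (W.conductorNorm ℤ)]
    (K : Type) [Field K] [NumberField K]
    (hZ : ZhangAtThreeNonsplit W K) (hMc : McCallum1991_pow_dvd_card_sha_primary_of_certificate)
    (hmult : W.HasMultiplicativeReductionAtPrime 3)
    (hns : ¬ W.HasSplitMultiplicativeReductionAtPrime 3)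
    (hρ : W.HasSurjectiveModNGaloisRep 3)
    (hfin_or : ¬ 3 ∣ padicValInt 3 W.minimalDiscriminantInt ∨
      (Squarefree (W.conductorNorm ℤ) ∨
        ∃ (ℓ₁ ℓ₂ : ℕ) (_ : Fact ℓ₁.Prime) (_ : Fact ℓ₂.Prime), ℓ₁ ≠ ℓ₂ ∧ ℓ₁ ≠ 3 ∧ ℓ₂ ≠ 3 ∧
          W.HasMultiplicativeReductionAtPrime ℓ₁ ∧ W.HasMultiplicativeReductionAtPrime ℓ₂))
    (hmult' : ∃ (ℓ : ℕ) (_ : Fact ℓ.Prime), ℓ ≠ 3 ∧ W.HasMultiplicativeReductionAtPrime ℓ ∧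
      ¬ 3 ∣ padicValInt ℓ W.minimalDiscriminantInt)
    (htam : ¬ 3 ∣ W.tamagawaProduct)
    (hK : IsImaginaryQuadratic K) (hH : SatisfiesHeegnerHypothesis (W.conductorNorm ℤ) K)
    (h3 : NumberField.discr K ≠ -3) (h4 : NumberField.discr K ≠ -4) (hCM : ¬ W.HasCM)
    (hrank : (W.baseChange K).mordellWeilRank = 1)
    (hiv : ∀ x : (W.baseChange K).toAffine.Point, 3 • x = 0 → x = 0)
    [Finite (W.baseChange K).sha] :
    ∃ (Dt : ModularParametrizationData W (W.conductorNorm ℤ)) (β : ℤ) (ι : K →+* ℂ),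
      ∀ (d₁ : KolyvaginHeegnerData Dt β ι 1) (P : (W.baseChange K).toAffine.Point),
        d₁.toGeomPoints d₁.derivedPoint = toGeomPoints (W.baseChange K) P →
        ¬ IsOfFinAddOrder P →
        ∀ (M₀ : ℕ), (∃ Q : (W.baseChange K).toAffine.Point, ((3 ^ M₀ : ℕ) : ℤ) • Q = P) →
          (¬ ∃ Q : (W.baseChange K).toAffine.Point, ((3 ^ (M₀ + 1) : ℕ) : ℤ) • Q = P) →
          IndexLowerBoundAt W 3 K P := by
  -- tower surjectivity at 3 is a THEOREM at a multiplicative 3 (Wuthrich 2014, Lemma 20; tree)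
  have hsurj : ∀ m : ℕ, W.HasSurjectiveModNGaloisRep (3 ^ m : ℕ) :=
    Rank1Residual.surjective_pow_three_of_mult_of_tateLine W hmult hρ
  obtain ⟨Dt, β, ι, n, d, hn, hne⟩ := hZ hmult hns hρ hfin_or hmult' htam hK hH h3
  exact ⟨Dt, β, ι, fun d₁ P hP hPinf M₀ hdiv hndiv ↦
    indexLowerBoundAt_of_kolyvaginClass_one_ne_zero_of_mccallum W K hMc hCM hK h3 h4 hH 3 (by norm_num)
      hsurj Dt β ι d₁ P hP hPinf hrank hiv hdiv hndiv d hn hne⟩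

/-! ### Appended (koly g4, 2026-08-25): the ♯-version of ADDENDUM A1 — a TYPED statement only

Per the planner's (R-aa) amendment (STATUS 18:54:10Z): "the `@[conjecture] def ZhangAtThreeNonsplitSharp`
+ bridge + its consumer MAY ride in the same file PROVIDED the ♯ docstring says «memo ADDENDUM A1, NOT
refereed; no census word attaches» (a typed statement, no claim — D-0059 wants typed objects where routes
can name them; the census discipline is kept by the docstring and by TARGET)". -/

/-- **Conjecture Z₃-ns♯ (typed; NOT asserted) — memo ADDENDUM A1, NOT refereed; no census word attaches.**
Kolyvagin's conjecture mod 3 for `E/ℚ` with NON-SPLIT multiplicative reduction at `3 ∥ N`, with NO further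
condition at 3: `ZhangAtThreeNonsplit` with the binder «`3 ∤ v₃(Δ_min)` ∨ (N square-free ∨ two
multiplicative primes ≠ 3)» REMOVED. Binders: `W` globally minimal; `3 ∥ N` multiplicative and NOT split;
`ρ̄_{E,3}` onto; Ram: `∃ ℓ₀ ≠ 3` multiplicative with `3 ∤ v_{ℓ₀}(Δ_min)`; `3 ∤ ∏ c_ℓ`; `K` imaginary
quadratic, Heegner for `N_E`, `d_K ≠ −3`. Memo-level argument (HOME `koly/MEMO-v3-ADDENDUM-A1.md`, lemma
L-St: the DEFINITE level-raised nodes are made 3-NEW by Ribet's level raising at the prime 3 itself on the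
definite quaternion algebra with Diamond–Taylor / Henniart type structures at the additive primes, so that
W. Zhang's Hypothesis ♥(2) holds there via the two primes `{3, ℓ₀}` exactly dividing the level, as in Z₃)
— UNREFEREED at filing time; the locus of record and every census word stay with `ZhangAtThreeNonsplit`
∪ `ZhangAtThreePrime` until a referee verdict and a planner ruling say otherwise. CONJECTURE
(hypothesis-shaped `Prop`, nothing asserted; cell bsd-stepL, seat koly).
[cite: WZhang2014, Thm. 1.1 (p. 195) and Thm. 9.1 (p. 240) — shape only, NOT printed at p = 3 nor at p ∣ N; nothing asserted] -/
@[conjecture] def ZhangAtThreeNonsplitSharp (W : WeierstrassCurve ℚ) [W.IsElliptic] [W.IsGloballyMinimal]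
    [NeZero (W.conductorNorm ℤ)] (K : Type) [Field K] [NumberField K] : Prop :=
  W.HasMultiplicativeReductionAtPrime 3 →
  ¬ W.HasSplitMultiplicativeReductionAtPrime 3 →
  W.HasSurjectiveModNGaloisRep 3 →
  (∃ (ℓ : ℕ) (_ : Fact ℓ.Prime), ℓ ≠ 3 ∧ W.HasMultiplicativeReductionAtPrime ℓ ∧
      ¬ 3 ∣ padicValInt ℓ W.minimalDiscriminantInt) →
  ¬ 3 ∣ W.tamagawaProduct →
  IsImaginaryQuadratic K → SatisfiesHeegnerHypothesis (W.conductorNorm ℤ) K →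
  NumberField.discr K ≠ -3 →
  ∃ (Dt : ModularParametrizationData W (W.conductorNorm ℤ)) (β : ℤ) (ι : K →+* ℂ) (n : ℕ)
    (d : KolyvaginHeegnerData Dt β ι n),
    KolyvaginDescent.KolSupp (Zhang2014.IsKolyvaginPrime (W.conductorNorm ℤ) W K 3) n ∧
      d.kolyvaginClass Nat.prime_three 1 ≠ 0

/-- **Z₃-ns♯ implies Z₃-ns**: `ZhangAtThreeNonsplit` carries one extra binder («`3 ∤ v₃(Δ_min)` ∨ (vi)»),
so the statement without it gives the one with it (bookkeeping only; nothing asserted about either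
conjecture). [folklore] -/
theorem zhangAtThreeNonsplit_of_zhangAtThreeNonsplitSharp (W : WeierstrassCurve ℚ) [W.IsElliptic]
    [W.IsGloballyMinimal] [NeZero (W.conductorNorm ℤ)] (K : Type) [Field K] [NumberField K]
    (h : ZhangAtThreeNonsplitSharp W K) : ZhangAtThreeNonsplit W K :=
  fun hmult hns hρ _ hram htam hK hH h3 ↦ h hmult hns hρ hram htam hK hH h3

/-- **Z₃-ns♯ ⇒ STEP L at 3** on the whole non-split locus: the same McCallum consumer as for Z₃ / Z₃′ /
Z₃-ns (`Koly.indexLowerBoundAt_of_kolyvaginClass_one_ne_zero_of_mccallum` at `p = 3`; tower surjectivity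
at a multiplicative 3 discharged by `Rank1Residual.surjective_pow_three_of_mult_of_tateLine`, Wuthrich
2014 Lemma 20). CONDITIONAL on `hMc`; `hZ : ZhangAtThreeNonsplitSharp W K` is a HYPOTHESIS (open,
unrefereed memo). [cite: McCallumLMS1991, §5 Cor. 5.6 (p. 310)] [cite: Wuthrich2014, Lemma 20 (p. 399)] -/
theorem exists_indexLowerBoundAt_three_of_zhangAtThreeNonsplitSharp_of_mccallum
    (W : WeierstrassCurve ℚ) [W.IsElliptic] [W.IsGloballyMinimal] [NeZero (W.conductorNorm ℤ)]
    (K : Type) [Field K] [NumberField K]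
    (hZ : ZhangAtThreeNonsplitSharp W K) (hMc : McCallum1991_pow_dvd_card_sha_primary_of_certificate)
    (hmult : W.HasMultiplicativeReductionAtPrime 3)
    (hns : ¬ W.HasSplitMultiplicativeReductionAtPrime 3)
    (hρ : W.HasSurjectiveModNGaloisRep 3)
    (hmult' : ∃ (ℓ : ℕ) (_ : Fact ℓ.Prime), ℓ ≠ 3 ∧ W.HasMultiplicativeReductionAtPrime ℓ ∧
      ¬ 3 ∣ padicValInt ℓ W.minimalDiscriminantInt)
    (htam : ¬ 3 ∣ W.tamagawaProduct)
    (hK : IsImaginaryQuadratic K) (hH : SatisfiesHeegnerHypothesis (W.conductorNorm ℤ) K)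
    (h3 : NumberField.discr K ≠ -3) (h4 : NumberField.discr K ≠ -4) (hCM : ¬ W.HasCM)
    (hrank : (W.baseChange K).mordellWeilRank = 1)
    (hiv : ∀ x : (W.baseChange K).toAffine.Point, 3 • x = 0 → x = 0)
    [Finite (W.baseChange K).sha] :
    ∃ (Dt : ModularParametrizationData W (W.conductorNorm ℤ)) (β : ℤ) (ι : K →+* ℂ),
      ∀ (d₁ : KolyvaginHeegnerData Dt β ι 1) (P : (W.baseChange K).toAffine.Point),
        d₁.toGeomPoints d₁.derivedPoint = toGeomPoints (W.baseChange K) P →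
        ¬ IsOfFinAddOrder P →
        ∀ (M₀ : ℕ), (∃ Q : (W.baseChange K).toAffine.Point, ((3 ^ M₀ : ℕ) : ℤ) • Q = P) →
          (¬ ∃ Q : (W.baseChange K).toAffine.Point, ((3 ^ (M₀ + 1) : ℕ) : ℤ) • Q = P) →
          IndexLowerBoundAt W 3 K P := by
  -- tower surjectivity at 3 is a THEOREM at a multiplicative 3 (Wuthrich 2014, Lemma 20; tree)
  have hsurj : ∀ m : ℕ, W.HasSurjectiveModNGaloisRep (3 ^ m : ℕ) :=
    Rank1Residual.surjective_pow_three_of_mult_of_tateLine W hmult hρ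
  obtain ⟨Dt, β, ι, n, d, hn, hne⟩ := hZ hmult hns hρ hmult' htam hK hH h3
  exact ⟨Dt, β, ι, fun d₁ P hP hPinf M₀ hdiv hndiv ↦
    indexLowerBoundAt_of_kolyvaginClass_one_ne_zero_of_mccallum W K hMc hCM hK h3 h4 hH 3 (by norm_num)
      hsurj Dt β ι d₁ P hP hPinf hrank hiv hdiv hndiv d hn hne⟩


/-! ### Appended (koly g5, 2026-08-25): the umbrella Z₃♯ — a TYPED statement only

Cell `bsd-stepL`, memo `koly/MEMO-v4.md` (THEOREM B♭ = Skinner 2016 Thm B without its hypothesis (iii)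
«𝓛(V_f) ≠ 0»; THEOREM Z₃-sp = the split branch without the clause (ii′)). A typed statement, no claim; the
census discipline is kept by the docstring and by TARGET: no census word attaches to `ZhangAtThreeSharp` until a
referee verdict on MEMO-v4 and a planner ruling say so. -/

/-- **Conjecture Z₃♯ (typed; NOT asserted) — memo MEMO-v4 (koly g5); no census word attaches until a referee
verdict and a planner ruling.** Kolyvagin's conjecture mod 3 for `E/ℚ` with multiplicative reduction at `3 ∥ N`
(split OR non-split), with NO further condition at 3: `ZhangAtThreeNonsplitSharp` with the binder «non-split at 3»
REMOVED (equivalently `ZhangAtThreePrime` with (ii) «`3 ∤ v₃(Δ_min)`» and the split-3 `𝓛`-clause (ii′) removed).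
Binders: `W` globally minimal; `3 ∥ N` multiplicative; `ρ̄_{E,3}` onto; Ram: `∃ ℓ₀ ≠ 3` multiplicative with
`3 ∤ v_{ℓ₀}(Δ_min)`; `3 ∤ ∏ c_ℓ`; `K` imaginary quadratic, Heegner for `N_E`, `d_K ≠ −3`. Memo-level argument
(HOME `koly/MEMO-v4.md`): on the split branch the clause (ii′) is used in the Skinner–Zhang / W. Zhang chain ONLY
to guarantee hypothesis (iii) «`𝓛(V_{g'}) ≠ 0`» of Skinner, PJM 283 (2016) Thm B for the level-raised forms `g'`
(SZ14 p. 3, §2.8, Thms 9.7/9.8/9.11, proof of Thm 10.1); THEOREM B♭ of the memo proves the conclusion of Skinner's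
Thm B for `p`-new weight-2 forms with `a_p = 1` WITHOUT (iii), by comparing Σ-relaxed Greenberg Selmer groups over
`ℚ` of `g'` and of the good-ordinary members of its Hida family (no trivial zero there) and passing to the limit
with the Greenberg–Stevens improved `p`-adic `L`-function; on the split branch (ii) follows from `3 ∤ ∏ c_ℓ`
(`c₃ = v₃(Δ_min)`); the non-split branch is `ZhangAtThreeNonsplitSharp` (ADDENDUM A1). CONJECTURE
(hypothesis-shaped `Prop`, nothing asserted; cell bsd-stepL, seat koly).
[cite: WZhang2014, Thm. 1.1 (p. 195) and Thm. 9.1 (p. 240) — shape only, NOT printed at p = 3 nor at p ∣ N; nothing asserted]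
[cite: SkinnerZhang2014, Thm. 1.3 (§1) — shape only; its clause «log_p q_E ∈ pℤ_p^×» is the binder removed here; nothing asserted] -/
@[conjecture] def ZhangAtThreeSharp (W : WeierstrassCurve ℚ) [W.IsElliptic] [W.IsGloballyMinimal]
    [NeZero (W.conductorNorm ℤ)] (K : Type) [Field K] [NumberField K] : Prop :=
  W.HasMultiplicativeReductionAtPrime 3 →
  W.HasSurjectiveModNGaloisRep 3 →
  (∃ (ℓ : ℕ) (_ : Fact ℓ.Prime), ℓ ≠ 3 ∧ W.HasMultiplicativeReductionAtPrime ℓ ∧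
      ¬ 3 ∣ padicValInt ℓ W.minimalDiscriminantInt) →
  ¬ 3 ∣ W.tamagawaProduct →
  IsImaginaryQuadratic K → SatisfiesHeegnerHypothesis (W.conductorNorm ℤ) K →
  NumberField.discr K ≠ -3 →
  ∃ (Dt : ModularParametrizationData W (W.conductorNorm ℤ)) (β : ℤ) (ι : K →+* ℂ) (n : ℕ)
    (d : KolyvaginHeegnerData Dt β ι n),
    KolyvaginDescent.KolSupp (Zhang2014.IsKolyvaginPrime (W.conductorNorm ℤ) W K 3) n ∧
      d.kolyvaginClass Nat.prime_three 1 ≠ 0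

/-- **Z₃♯ implies Z₃′**: `ZhangAtThreePrime` carries two extra binders ((ii) and the split-3 `𝓛`-clause (ii′)), so
the statement without them gives the one with them (bookkeeping only; nothing asserted about either conjecture).
[folklore] -/
theorem zhangAtThreePrime_of_zhangAtThreeSharp (W : WeierstrassCurve ℚ) [W.IsElliptic]
    [W.IsGloballyMinimal] [NeZero (W.conductorNorm ℤ)] (K : Type) [Field K] [NumberField K]
    (h : ZhangAtThreeSharp W K) : ZhangAtThreePrime W K :=
  fun hmult hρ _ _ hram htam hK hH h3 ↦ h hmult hρ hram htam hK hH h3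

/-- **Z₃♯ implies Z₃-ns♯**: `ZhangAtThreeNonsplitSharp` carries the extra binder «non-split at 3», so the statement
without it gives the one with it (bookkeeping only; nothing asserted about either conjecture). [folklore] -/
theorem zhangAtThreeNonsplitSharp_of_zhangAtThreeSharp (W : WeierstrassCurve ℚ) [W.IsElliptic]
    [W.IsGloballyMinimal] [NeZero (W.conductorNorm ℤ)] (K : Type) [Field K] [NumberField K]
    (h : ZhangAtThreeSharp W K) : ZhangAtThreeNonsplitSharp W K :=
  fun hmult _ hρ hram htam hK hH h3 ↦ h hmult hρ hram htam hK hH h3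

/-- **Z₃♯ ⇒ STEP L at 3** on the whole atom A1: the same McCallum consumer as for Z₃ / Z₃′ / Z₃-ns / Z₃-ns♯
(`Koly.indexLowerBoundAt_of_kolyvaginClass_one_ne_zero_of_mccallum` at `p = 3`; tower surjectivity at a
multiplicative 3 discharged by `Rank1Residual.surjective_pow_three_of_mult_of_tateLine`, Wuthrich 2014 Lemma 20).
CONDITIONAL on `hMc`; `hZ : ZhangAtThreeSharp W K` is a HYPOTHESIS (open).
[cite: McCallumLMS1991, §5 Cor. 5.6 (p. 310)] [cite: Wuthrich2014, Lemma 20 (p. 399)] -/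
theorem exists_indexLowerBoundAt_three_of_zhangAtThreeSharp_of_mccallum
    (W : WeierstrassCurve ℚ) [W.IsElliptic] [W.IsGloballyMinimal] [NeZero (W.conductorNorm ℤ)]
    (K : Type) [Field K] [NumberField K]
    (hZ : ZhangAtThreeSharp W K) (hMc : McCallum1991_pow_dvd_card_sha_primary_of_certificate)
    (hmult : W.HasMultiplicativeReductionAtPrime 3)
    (hρ : W.HasSurjectiveModNGaloisRep 3)
    (hmult' : ∃ (ℓ : ℕ) (_ : Fact ℓ.Prime), ℓ ≠ 3 ∧ W.HasMultiplicativeReductionAtPrime ℓ ∧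
      ¬ 3 ∣ padicValInt ℓ W.minimalDiscriminantInt)
    (htam : ¬ 3 ∣ W.tamagawaProduct)
    (hK : IsImaginaryQuadratic K) (hH : SatisfiesHeegnerHypothesis (W.conductorNorm ℤ) K)
    (h3 : NumberField.discr K ≠ -3) (h4 : NumberField.discr K ≠ -4) (hCM : ¬ W.HasCM)
    (hrank : (W.baseChange K).mordellWeilRank = 1)
    (hiv : ∀ x : (W.baseChange K).toAffine.Point, 3 • x = 0 → x = 0)
    [Finite (W.baseChange K).sha] :
    ∃ (Dt : ModularParametrizationData W (W.conductorNorm ℤ)) (β : ℤ) (ι : K →+* ℂ),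
      ∀ (d₁ : KolyvaginHeegnerData Dt β ι 1) (P : (W.baseChange K).toAffine.Point),
        d₁.toGeomPoints d₁.derivedPoint = toGeomPoints (W.baseChange K) P →
        ¬ IsOfFinAddOrder P →
        ∀ (M₀ : ℕ), (∃ Q : (W.baseChange K).toAffine.Point, ((3 ^ M₀ : ℕ) : ℤ) • Q = P) →
          (¬ ∃ Q : (W.baseChange K).toAffine.Point, ((3 ^ (M₀ + 1) : ℕ) : ℤ) • Q = P) →
          IndexLowerBoundAt W 3 K P := by
  -- tower surjectivity at 3 is a THEOREM at a multiplicative 3 (Wuthrich 2014, Lemma 20; tree)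
  have hsurj : ∀ m : ℕ, W.HasSurjectiveModNGaloisRep (3 ^ m : ℕ) :=
    Rank1Residual.surjective_pow_three_of_mult_of_tateLine W hmult hρ
  obtain ⟨Dt, β, ι, n, d, hn, hne⟩ := hZ hmult hρ hmult' htam hK hH h3
  exact ⟨Dt, β, ι, fun d₁ P hP hPinf M₀ hdiv hndiv ↦
    indexLowerBoundAt_of_kolyvaginClass_one_ne_zero_of_mccallum W K hMc hCM hK h3 h4 hH 3 (by norm_num)
      hsurj Dt β ι d₁ P hP hPinf hrank hiv hdiv hndiv d hn hne⟩

/-! ### Appended (koly g6, 2026-08-26): Z₃♯ at EVERY Manin-good frame — the (R2′) re-typing of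
`plan/K2KOLY/DESIGN.md` §3 (seam G-b), a TYPED statement only

`ZhangAtThreeSharp` concludes `∃ (Dt, β, ι) …`: a frame of ITS choice. The single-odd-datum consumer of the class
record (`X11b.bsdp_of_indexLowerBoundAt_of_heegnerData_of_odd`) and the koly glue
(`Koly.bsdp_three_onA1_of_kolyvaginFrames`, `Theorems/ClassRecordThreeKolyGlue.lean`) need the non-zero class AT
THE CONSUMER'S frame. Kolyvagin's conjecture mod 3 is frame-independent exactly up to the Manin constant: a
parametrisation through `[3]` multiplies every Heegner point by 3 and kills every mod-3 class, so the ∀-form must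
carry `¬ 3 ∣ c(Dt)` (as the additive cell's `RKC3Indivisibility` does). Same memo chain (MEMO-v2 → v4, referee
PASS g5 ∕ g12 ∕ g13 ∕ g17 ∕ g19): the argument runs at any Manin-good X₀(N)-parametrisation. No census word attaches
to the new decl beyond Z₃♯'s (same locus A1). -/

/-- **Conjecture Z₃♯ at every Manin-good frame (typed; NOT asserted) — DESIGN `KolyvaginRoadThree` §3 (R2′).**
Binders of `ZhangAtThreeSharp` (`3 ∥ N` multiplicative; `ρ̄_{E,3}` onto; a (ram) prime; `3 ∤ ∏ c_ℓ`; `K`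
imaginary quadratic, Heegner for `N_E`, `d_K ≠ −3`); conclusion: for EVERY modular parametrisation datum `Dt`
of level `N_E` with `3 ∤ c(Dt)` (Manin-good), every orientation `β` with `4N ∣ β² − d_K` and every `ι : K → ℂ`,
some Kolyvagin–Heegner datum `d` at a square-free product `n` of Kolyvagin primes ON THAT FRAME has `c₁(n) ≠ 0`.
Implies `ZhangAtThreeSharp` at any Manin-good frame (`zhangAtThreeSharp_of_frame`); its ∀-closure is exactly the
hypothesis `hZ` of `Koly.bsdp_three_onA1_of_kolyvaginFrames` (`kolyvaginFrames_of_forall_zhangAtThreeSharpFrame`).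
CONJECTURE (hypothesis-shaped `Prop`, nothing asserted; cell bsd-stepL, seat koly; memos MEMO-v2/v4, DESIGN
`plan/K2KOLY`). [cite: WZhang2014, Thm. 1.1 (p. 195) and §3 ((𝒪,𝔭)-optimal parametrisations, p. 211) — shape only; nothing asserted] -/
@[conjecture] def ZhangAtThreeSharpFrame (W : WeierstrassCurve ℚ) [W.IsElliptic] [W.IsGloballyMinimal]
    [NeZero (W.conductorNorm ℤ)] (K : Type) [Field K] [NumberField K] : Prop :=
  W.HasMultiplicativeReductionAtPrime 3 →
  W.HasSurjectiveModNGaloisRep 3 →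
  (∃ (ℓ : ℕ) (_ : Fact ℓ.Prime), ℓ ≠ 3 ∧ W.HasMultiplicativeReductionAtPrime ℓ ∧
      ¬ 3 ∣ padicValInt ℓ W.minimalDiscriminantInt) →
  ¬ 3 ∣ W.tamagawaProduct →
  IsImaginaryQuadratic K → SatisfiesHeegnerHypothesis (W.conductorNorm ℤ) K →
  NumberField.discr K ≠ -3 →
  ∀ (Dt : ModularParametrizationData W (W.conductorNorm ℤ)) (β : ℤ) (ι : K →+* ℂ),
    (4 * (W.conductorNorm ℤ : ℤ)) ∣ β ^ 2 - NumberField.discr K → ¬ (3 : ℤ) ∣ Dt.c →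
    ∃ (n : ℕ) (d : KolyvaginHeegnerData Dt β ι n),
      KolyvaginDescent.KolSupp (Zhang2014.IsKolyvaginPrime (W.conductorNorm ℤ) W K 3) n ∧
        d.kolyvaginClass Nat.prime_three 1 ≠ 0

/-- **The frame form gives Z₃♯ at any Manin-good frame** (bookkeeping: `ZhangAtThreeSharp` asks for SOME frame;
supply the given one). Nothing is asserted about either conjecture. [folklore] -/
theorem zhangAtThreeSharp_of_frame (W : WeierstrassCurve ℚ) [W.IsElliptic] [W.IsGloballyMinimal]
    [NeZero (W.conductorNorm ℤ)] (K : Type) [Field K] [NumberField K]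
    (hF : ZhangAtThreeSharpFrame W K) (Dt : ModularParametrizationData W (W.conductorNorm ℤ)) (β : ℤ)
    (ι : K →+* ℂ) (hβ : (4 * (W.conductorNorm ℤ : ℤ)) ∣ β ^ 2 - NumberField.discr K)
    (hc : ¬ (3 : ℤ) ∣ Dt.c) : ZhangAtThreeSharp W K :=
  fun hmult hρ hram htam hK hH h3 ↦ by
    obtain ⟨n, d, hn, hne⟩ := hF hmult hρ hram htam hK hH h3 Dt β ι hβ hc
    exact ⟨Dt, β, ι, n, d, hn, hne⟩

/-- **The ∀-closure of the frame form is the glue's hypothesis `hZ`** (`Koly.bsdp_three_onA1_of_kolyvaginFrames`,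
`Theorems/ClassRecordThreeKolyGlue.lean`): binder re-ordering only. [folklore] -/
theorem kolyvaginFrames_of_forall_zhangAtThreeSharpFrame
    (hF : ∀ (W : WeierstrassCurve ℚ) [W.IsElliptic] [W.IsGloballyMinimal] [NeZero (W.conductorNorm ℤ)]
      (K : Type) [Field K] [NumberField K], ZhangAtThreeSharpFrame W K) :
    ∀ (W : WeierstrassCurve ℚ) [W.IsElliptic] [W.IsGloballyMinimal] [NeZero (W.conductorNorm ℤ)]
      (K : Type) [Field K] [NumberField K]
      (Dt : ModularParametrizationData W (W.conductorNorm ℤ)) (β : ℤ) (ι : K →+* ℂ),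
      W.HasMultiplicativeReductionAtPrime 3 → W.HasSurjectiveModNGaloisRep 3 →
      (∃ (ℓ : ℕ) (_ : Fact ℓ.Prime), ℓ ≠ 3 ∧ W.HasMultiplicativeReductionAtPrime ℓ ∧
        ¬ 3 ∣ padicValInt ℓ W.minimalDiscriminantInt) →
      ¬ 3 ∣ W.tamagawaProduct →
      IsImaginaryQuadratic K → SatisfiesHeegnerHypothesis (W.conductorNorm ℤ) K →
      NumberField.discr K ≠ -3 →
      (4 * (W.conductorNorm ℤ : ℤ)) ∣ β ^ 2 - NumberField.discr K → ¬ (3 : ℤ) ∣ Dt.c →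
      ∃ (n : ℕ) (d : KolyvaginHeegnerData Dt β ι n),
        KolyvaginDescent.KolSupp (Zhang2014.IsKolyvaginPrime (W.conductorNorm ℤ) W K 3) n ∧
          d.kolyvaginClass Nat.prime_three 1 ≠ 0 :=
  fun W _ _ _ K _ _ Dt β ι hmult hρ hram htam hK hH h3 hβ hc ↦
    hF W K hmult hρ hram htam hK hH h3 Dt β ι hβ hc

end Summit.BirchSwinnertonDyer.Rank1Residual.X11b.Three.Koly

end
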